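import Mathlib.MeasureTheory.Group.Measure
import Mathlib.MeasureTheory.Integral.Bochner.Set
import Mathlib.MeasureTheory.Measure.Prod
import HarnessLib

/-!
# Averaging a coset-constant factor out of an integral over `A × G` with a right invariant measure

Topic `MeasureTheory/Group`; namespace `Literature.MeasureTheory.Group`. Theorems only.

Let `μ = ν_A × ν_G` on `A × G`, where `G` is a group with a RIGHT invariant (s-finite) measure
`ν_G`, and let a finite group `Q` label "cosets" through a map `c : A × G → Q` which is equivariant
for right translation by representatives `ρ q ∈ G`: `c (a, g ρ(q)) = c (a, g) · q`. If `Γ : A × G → E`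
is invariant under these right translations, then the `Q`-pieces `{c = q}` of `S ×ˢ univ` all carry the
same integral of `Γ` (the translation by `ρ q` is measure preserving and maps `{c = 1}` onto `{c = q}`),
and consequently a factor that is constant on the pieces averages out:

  `∫_{S × G} F(c p) Γ(p) dμ = ((#Q)⁻¹ ∑_q F q) · ∫_{S × G} Γ(p) dμ`

(`setIntegral_mul_eq_avg_mul_setIntegral`). This is the device by which a locally constant
finite-adelic factor (constant on the cosets of a normal compact open subgroup of finite index) is
averaged out of an integral over `(torus) × (maximal compact subgroup)` against a Haar measure of the
compact factor, leaving an archimedean integral.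

## References

Standard measure theory (change of variables for measure-preserving equivalences, Mathlib
`MeasureTheory.MeasurePreserving.setIntegral_preimage_emb`). [folklore]
-/

noncomputable section

open MeasureTheory MeasureTheory.Measure Set Filter

namespace Literature.MeasureTheory.Group

variable {A G Q : Type*} [MeasurableSpace A] [Group G] [MeasurableSpace G] [MeasurableMul G]
  [Group Q]

/-- **The pieces `{c = q}` of `S × G` carry the same integral of a translation-invariant
function.** With `c (a, g ρ(q)) = c (a, g) · q` and `Γ (a, g ρ(q)) = Γ (a, g)`, right translation
by `ρ q` (measure preserving for `ν_A × ν_G`, `ν_G` right invariant) maps `(S ×ˢ univ) ∩ {c = 1}`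
onto `(S ×ˢ univ) ∩ {c = q}`. [folklore] -/
theorem setIntegral_inter_fiber_eq (νA : Measure A) [SFinite νA] (νG : Measure G) [SFinite νG]
    [νG.IsMulRightInvariant] {c : A × G → Q} (hc : ∀ q, MeasurableSet (c ⁻¹' {q})) (ρ : Q → G)
    (hρ : ∀ (p : A × G) (q : Q), c (p.1, p.2 * ρ q) = c p * q) {S : Set A} (hS : MeasurableSet S)
    (Γ : A × G → ℂ) (hΓ : ∀ (p : A × G) (q : Q), Γ (p.1, p.2 * ρ q) = Γ p) (q : Q) :
    ∫ p in (S ×ˢ (univ : Set G)) ∩ c ⁻¹' {q}, Γ p ∂(νA.prod νG) =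
      ∫ p in (S ×ˢ (univ : Set G)) ∩ c ⁻¹' {1}, Γ p ∂(νA.prod νG) := by
  -- right translation by `ρ q` as a measure-preserving measurable equivalence of `A × G`
  set e : A × G ≃ᵐ A × G := MeasurableEquiv.prodCongr (MeasurableEquiv.refl A) (MeasurableEquiv.mulRight (ρ q))
    with he
  have hea : ∀ p : A × G, e p = (p.1, p.2 * ρ q) := fun p => rfl
  have hmp : MeasurePreserving e (νA.prod νG) (νA.prod νG) := by
    have h := (MeasurePreserving.id νA).prod (measurePreserving_mul_right νG (ρ q))
    have hfun : (⇑e : A × G → A × G) = Prod.map id fun x => x * ρ q := funext fun p => rfl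
    rw [hfun]
    exact h
  have hpre : e ⁻¹' ((S ×ˢ (univ : Set G)) ∩ c ⁻¹' {q}) = (S ×ˢ (univ : Set G)) ∩ c ⁻¹' {1} := by
    ext p
    simp only [mem_preimage, mem_inter_iff, mem_prod, mem_univ, and_true, mem_singleton_iff, hea, hρ]
    constructor
    · rintro ⟨hS, hcq⟩
      exact ⟨hS, mul_right_cancel (a := c p) (b := q) (c := 1) (by rw [one_mul]; exact hcq)⟩
    · rintro ⟨hS, hc1⟩
      exact ⟨hS, by rw [hc1, one_mul]⟩
  have h := hmp.setIntegral_preimage_emb e.measurableEmbedding Γ ((S ×ˢ (univ : Set G)) ∩ c ⁻¹' {q})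
  rw [hpre] at h
  rw [← h]
  exact setIntegral_congr_fun ((hS.prod MeasurableSet.univ).inter (hc 1)) fun p _ => by rw [hea, hΓ]

omit [Group Q] in
/-- `∑_q 𝟙_{c = q}(p) g_q(p) = g_{c(p)}(p)`: a sum of indicators over the fibres of `c` picks the
fibre of `p`. [folklore] -/
theorem sum_indicator_fiber_apply [Fintype Q] [DecidableEq Q] {X E : Type*} [AddCommMonoid E]
    (c : X → Q) (g : Q → X → E) (p : X) :
    ∑ q, (c ⁻¹' {q}).indicator (g q) p = g (c p) p := by
  rw [Finset.sum_eq_single (c p)]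
  · exact Set.indicator_of_mem (by simp) _
  · intro q _ hq
    exact Set.indicator_of_notMem (by simpa [Set.mem_preimage] using fun h => hq h.symm) _
  · exact fun h => absurd (Finset.mem_univ _) h

/-- **Averaging a coset-constant factor out of the integral.** With `c`, `ρ`, `Γ` as in
`setIntegral_inter_fiber_eq` (all fibres of `S × G` carry the same integral `J` of `Γ`) and `Γ`
integrable on `S × G`: `∫_{S × G} Γ = #Q · J`, and for any `F : Q → ℂ`,
`∫_{S × G} F(c p) Γ(p) = (∑_q F q) · J = ((#Q)⁻¹ ∑_q F q) · ∫_{S × G} Γ`. [folklore] -/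
theorem setIntegral_mul_eq_avg_mul_setIntegral [Fintype Q] [DecidableEq Q]
    (νA : Measure A) [SFinite νA] (νG : Measure G) [SFinite νG]
    [νG.IsMulRightInvariant] {c : A × G → Q} (hc : ∀ q, MeasurableSet (c ⁻¹' {q})) (ρ : Q → G)
    (hρ : ∀ (p : A × G) (q : Q), c (p.1, p.2 * ρ q) = c p * q) {S : Set A} (hS : MeasurableSet S)
    (F : Q → ℂ) (Γ : A × G → ℂ) (hΓ : ∀ (p : A × G) (q : Q), Γ (p.1, p.2 * ρ q) = Γ p)
    (hint : IntegrableOn Γ (S ×ˢ (univ : Set G)) (νA.prod νG)) :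
    ∫ p in S ×ˢ (univ : Set G), F (c p) * Γ p ∂(νA.prod νG) =
      ((Fintype.card Q : ℂ)⁻¹ * ∑ q, F q) * ∫ p in S ×ˢ (univ : Set G), Γ p ∂(νA.prod νG) := by
  set μ := νA.prod νG with hμ
  set T : Set (A × G) := S ×ˢ (univ : Set G) with hT
  set J : Q → ℂ := fun q => ∫ p in T ∩ c ⁻¹' {q}, Γ p ∂μ with hJ
  have hJ1 : ∀ q, J q = J 1 := fun q => setIntegral_inter_fiber_eq νA νG hc ρ hρ hS Γ hΓ q
  -- `∫_T Γ = ∑_q J q = #Q · J 1`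
  have hsumΓ : ∫ p in T, Γ p ∂μ = ∑ q, J q := by
    have hpt : (fun p => Γ p) = fun p => ∑ q, (c ⁻¹' {q}).indicator Γ p := by
      funext p
      rw [sum_indicator_fiber_apply c (fun _ => Γ) p]
    rw [hpt, integral_finsetSum _ (fun q _ => (hint.integrable.indicator (hc q)))]
    refine Finset.sum_congr rfl fun q _ => ?_
    rw [setIntegral_indicator (hc q)]
  have hcard : (Fintype.card Q : ℂ) ≠ 0 := Nat.cast_ne_zero.2 Fintype.card_ne_zero
  have hJ1eq : J 1 = (Fintype.card Q : ℂ)⁻¹ * ∫ p in T, Γ p ∂μ := by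
    rw [hsumΓ, Finset.sum_congr rfl (fun q (_ : q ∈ Finset.univ) => hJ1 q), Finset.sum_const,
      Finset.card_univ, nsmul_eq_mul, ← mul_assoc, inv_mul_cancel₀ hcard, one_mul]
  -- `∫_T F(c p) Γ p = ∑_q F q · J q`
  have hsumF : ∫ p in T, F (c p) * Γ p ∂μ = ∑ q, F q * J q := by
    have hpt : (fun p => F (c p) * Γ p) = fun p => ∑ q, (c ⁻¹' {q}).indicator (fun p => F q * Γ p) p := by
      funext p
      rw [sum_indicator_fiber_apply c (fun q p => F q * Γ p) p]
    rw [hpt, integral_finsetSum _ (fun q _ => ((hint.integrable.const_mul (F q)).indicator (hc q)))]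
    refine Finset.sum_congr rfl fun q _ => ?_
    rw [setIntegral_indicator (hc q), integral_const_mul]
  rw [hsumF, Finset.sum_congr rfl (fun q (_ : q ∈ Finset.univ) => by rw [hJ1 q]), ← Finset.sum_mul, hJ1eq]
  ring

end Literature.MeasureTheory.Group
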